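import Literature.MathematicalPhysics.QuantumFieldTheory.Balaban1983to89.StrongCouplingTorusWindow
import Literature.MathematicalPhysics.QuantumFieldTheory.SUNBakryEmeryPoincare
import Literature.MathematicalPhysics.QuantumLattice.SU2Haar
import HarnessLib

/-!
# `Balaban1983to89.StrongCouplingKernelWindow` — the strong-coupling front of `SU(2)` lattice Yang–Mills in `d = 4`
# WITHOUT HYPOTHESES: Shen–Zhu–Zhu's window `β_W < 1/12` through the tree's Bakry–Émery theorem, and a sharpened
# one-link Kantorovich–Rubinstein modulus giving the window `β_W ≤ 1/9` (pure kernel)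

**Observatory of the non-perturbative crossover; no mass-gap claim.**

Audit cell `pub-balaban`, build IR-4, seat `b2b-balaban-ir-sc-g4` (strong-coupling front, generation 4).  The three
sibling modules of this seat (`StrongCouplingKPWindow`, `StrongCouplingDobrushinWindow`, `StrongCouplingTorusWindow`)
turn ONE explicit one-link hypothesis — the Kantorovich–Rubinstein modulus `OneLinkKRModulus N R K` of the single-link
Gibbs law `ν_B(dg) ∝ exp(N Re tr(g B)) dHaar`, or the one-link Poincaré inequality `hLP` — into the two strong-coupling
currencies of the crossover ledger (`ir/UNITS.md`): SC-a, the infinite-volume DLR currency `DLRMassGapAt` /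
`HasUniqueGibbsMeasure ∧ DLRClusteringAt`, and SC-b, the volume-uniform torus currency
`CrossoverLedger.StrongCouplingFront`.  Until now the hypothesis was decided OFF kernel (a certificate, or a
published result quoted with page).  This module removes the hypothesis, twice.

## Part A — the published window, hypothesis-free

The tree's module `SUNBakryEmeryPoincare` PROVES the one-link Poincaré inequality `SUNBakryEmery.haarPoincare_SU`
(`Var_{ν_B}(ψ) ≤ M²/(N(1/2 − ‖B‖_op))` for `M`-Lipschitz `ψ`, `N ≥ 2`, `‖B‖_op < 1/2`) — literally the hypothesis `hLP`
of `oneLinkKRModulus_of_haarPoincare`, `dlrMassGapAt_of_haarPoincare` and `su2_strongCouplingFront_of_haarPoincare`.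
One application each gives, with NO hypothesis left (`oneLinkKRModulus_SU`, `dlrMassGapAt_SU`,
`su2_dlrMassGapAt_of_lt_twelfth`, `su2_strongCouplingFront_of_lt_twelfth`): for `SU(N)`, `d ≥ 2`,
`|β| < 1/(16(d−1))` ('t Hooft units) the DLR mass gap; for `SU(2)`, `d = 4`, every Wilson `β_W < 1/12` the DLR mass
gap at `β_W/4` and the front `StrongCouplingFront (fundamentalLatticeRep 2) (β_W/2)`; and for `SU(N)`, `N ≥ 2`, `d = 4`
the front `StrongCouplingFront (fundamentalLatticeRep N) β₀` for every tree coupling `β₀ < N/48` (`strongCouplingFront_SU`).  This is Shen–Zhu–Zhu,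
CMP 400 (2023), Assumption 1.1 / Thm. 1.2 / Cor. 1.6 "Mass gap", now a kernel theorem end to end (nothing beyond their window
is claimed in Part A).

## Part B — a sharper one-link modulus for `SU(2)` (elementary; new constant, same currencies)

The Bakry–Émery route bounds BOTH variances in `|Cov_{ν}(φ, w)| ≤ (Var φ · Var w)^{1/2}` by the Poincaré inequality.
For the perturbation `w(g) = 2 Re tr(g Δ)`, `Δ = B' − B`, which is a LINEAR function of the unit quaternion of `g`, the
variance can instead be computed: by left-invariance of Haar measure under the quaternion units `i, j, k ∈ SU(2)` and
the Parseval identity `∑_{u ∈ {1,i,j,k}} ⟨u q, c⟩² = |c|² |q|²` (a polynomial identity),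
`∫ (Re tr(g Δ))² dHaar = |c(Δ)|²/4 ≤ ‖Δ‖_F²/2` (`integral_sq_re_trace_su2_mul`), and under the tilt
`exp(F)`, `|F| ≤ κ ≤ 1`, `∫ F = ∫ w² F = 0` (oddness under `g ↦ −g`), the second moment grows at most by the factor
`1 + κ²/2 + 2κ³/9` (`integral_tilted_le_of_odd`, from Mathlib's `Real.exp_bound`).  Feeding this, together with the
tree's Poincaré bound for the OBSERVABLE `φ` only, into the covariance form of the tilt-interpolation lemma
(`abs_integral_tilted_add_sub_le_of_cov`: `|∫ φ dμ^{f+w} − ∫ φ dμ^{f}| ≤ sup_t |Cov_{μ^{f+tw}}(φ, w)|`, proved by the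
same discrete interpolation as the tree's `abs_integral_tilted_add_sub_le`) gives

  `oneLinkKRModulus_su2 : 0 ≤ R ≤ 1/4 → OneLinkKRModulus 2 R (√(2 (1 + 8R² + 128R³/9) / (1 − 2R)))`

(versus `1/(1/2 − R)` from Part A: at `R → 0` the constant is `√2` instead of `2`).  In Wilson units (`R = 3β_W/2`,
`K = 4 K₂`) the Dobrushin condition `18 β_W K₂ < 1` becomes `81 β_W² (1 + 18 β_W² + 48 β_W³) < 2 (1 − 3 β_W)`, which
holds at `β_W = 1/9` (`313/243 < 4/3`) and up to `β_W = 0.11239…`, where it fails.  Corollaries, all hypothesis-free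
(`su2_strongCouplingFront_sharp`, `su2_strongCouplingFront_ninth`, `su2_dlrMassGap_sharp`, `su2_dlrMassGapAt_ninth`):
the `SU(2)`, `d = 4` strong-coupling front and DLR mass gap hold for every Wilson `β_W ≤ 1/9` — i.e. `g² ≥ 36`
(`β_W = 4/g²`) against `g² > 48` for the printed window.  The improvement is a CONSTANT in a one-link estimate inside the
classical Dobrushin-uniqueness regime; it says nothing about the crossover or the continuum.

Every statement below is proved in the kernel from Mathlib and tree theorems (used, not cited); the `[cite: …]` tags
record the published results whose method is followed.  No statement of the manuscripts under audit is used.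

## References

* H. Shen, R. Zhu, X. Zhu, *A stochastic analysis approach to lattice Yang–Mills at strong coupling*, CMP 400 (2023)
  805–851, arXiv:2204.12737: Assumption 1.1, Thm. 1.2, Rem. 1.3 and the unnumbered remark after it (Dobrushin route, p. 6 of the arXiv v1 PDF),
  Lemma 4.1 (p. 17), (4.7)–(4.8) and Cor. 4.4 (4.11) (Bakry–Émery condition, Ricci curvature, Poincaré inequality; p. 19),
  Cor. 1.6 "Mass gap" (p. 7).
* R. L. Dobrushin, *Prescribing a system of random variables by conditional distributions*, Theory Probab. Appl. 15
  (1970) 458–486, Thm. 4; H. Föllmer, *Random fields and diffusion processes*, LNM 1362 (1988), Thm. 2.13.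
* D. Bakry, I. Gentil, M. Ledoux, *Analysis and Geometry of Markov Diffusion Operators*, Grundlehren 348 (2014), §4.8.
-/

noncomputable section

open MeasureTheory Filter Topology ProbabilityTheory Finset Real
open scoped NNReal Quaternion
open Literature.Probability.LatticeModels
open Literature.MathematicalPhysics.QuantumLattice (fundamentalRep fundamentalLatticeRep quatMatrix ymSpecification)

namespace Literature.MathematicalPhysics.QuantumFieldTheory.Balaban1983to89.StrongCouplingKernelWindow

open Literature.MathematicalPhysics.QuantumFieldTheory
open Literature.MathematicalPhysics.QuantumFieldTheory.Balaban1983to89.StrongCouplingDobrushinWindow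
open Literature.MathematicalPhysics.QuantumFieldTheory.Balaban1983to89.StrongCouplingTorusWindow

/-! ## Part A: the one-link Poincaré hypothesis discharged by the tree's Bakry–Émery theorem -/

section Discharge

/-- **One-link KR modulus of `SU(N)`, hypothesis-free**: for `N ≥ 2` and `R < 1/2`,
`OneLinkKRModulus N R (1/(1/2 − R))` — `oneLinkKRModulus_of_haarPoincare` with `hLP` supplied by the tree's
`SUNBakryEmery.haarPoincare_SU` (Shen–Zhu–Zhu Lemma 4.1 / (4.7)–(4.8), Cor. 4.4 (4.11) at one link).
[cite: arXiv220412737, Lemma 4.1 with (4.7)-(4.8), Cor. 4.4 (4.11) and Rem. 1.3] -/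
theorem oneLinkKRModulus_SU {N : ℕ} (hN : 2 ≤ N) {R : ℝ} (hR : R < 1 / 2) :
    OneLinkKRModulus N R (1 / (1 / 2 - R)) :=
  oneLinkKRModulus_of_haarPoincare (by omega) (SUNBakryEmery.haarPoincare_SU hN) hR

/-- **Shen–Zhu–Zhu's mass gap, hypothesis-free, in the DLR currency**: for `d ≥ 2`, `N ≥ 2` and
`|β| < 1/(16(d−1))` ('t Hooft units, tree coupling `N β`), `DLRMassGapAt d N β` (unique DLR state and exponential
clustering of Lipschitz cylinder covariances). [cite: arXiv220412737, Assumption 1.1, Thm. 1.2, Cor. 1.6 (Mass gap)] -/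
theorem dlrMassGapAt_SU {d N : ℕ} (hd : 2 ≤ d) (hN : 2 ≤ N) {β : ℝ}
    (hβ : |β| < 1 / (16 * ((d : ℝ) - 1))) : DLRMassGapAt d N β :=
  dlrMassGapAt_of_haarPoincare hd hN (SUNBakryEmery.haarPoincare_SU hN) hβ

/-- `SU(2)`, `d = 4`, Wilson units: every `0 ≤ β_W < 1/12` gives `DLRMassGapAt 4 2 (β_W/4)`, hypothesis-free.
[cite: arXiv220412737, Assumption 1.1, Thm. 1.2, Cor. 1.6 (Mass gap)] -/
theorem su2_dlrMassGapAt_of_lt_twelfth {βW : ℝ} (h0 : 0 ≤ βW) (hβ : βW < 1 / 12) :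
    DLRMassGapAt 4 2 (βW / 4) := by
  refine dlrMassGapAt_SU (d := 4) (N := 2) (by norm_num) le_rfl ?_
  rw [abs_of_nonneg (by positivity)]
  push_cast
  rw [lt_div_iff₀ (by norm_num)]
  linarith

/-- **The printed strong-coupling front of `SU(2)` in `d = 4`, hypothesis-free** (SC-b currency): every `β₀W < 1/12`
(Wilson) gives `StrongCouplingFront (fundamentalLatticeRep 2) (β₀W/2)` — `su2_strongCouplingFront_of_haarPoincare` with
`hLP := SUNBakryEmery.haarPoincare_SU`. [cite: arXiv220412737, Assumption 1.1, Thm. 1.2 (Uniqueness and ergodicity), Lemma 4.1, Cor. 1.6 (Mass gap)] -/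
theorem su2_strongCouplingFront_of_lt_twelfth {β₀W : ℝ} (hβ : β₀W < 1 / 12) :
    CrossoverLedger.StrongCouplingFront (fundamentalLatticeRep 2) (β₀W / 2) :=
  su2_strongCouplingFront_of_haarPoincare (SUNBakryEmery.haarPoincare_SU (N := 2) le_rfl) hβ

/-- **The printed window for `SU(N)`, `N ≥ 2`, `d = 4`, in the SC-b currency, hypothesis-free**: for tree coupling
`β₀ < N/48` ('t Hooft `β₀/N < 1/(16(d−1))`, `d = 4`; for `SU(2)` this is Wilson `β_W = 2β₀ < 1/12`, for `SU(3)`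
`β₀ < 1/16`) the front `StrongCouplingFront (fundamentalLatticeRep N) β₀` holds — `strongCouplingFront_of_oneLinkKRModulus`
with `R = 6β₀/N`, `K = 1/(1/2 − R)` from `oneLinkKRModulus_SU`; the Dobrushin constant is `18(β₀/N)/(1/2 − 6β₀/N) < 1 ⟺
β₀/N < 1/48`.  Shen–Zhu–Zhu's window in the finite-volume currency, kernel end to end (they print the infinite-volume
statement). [cite: arXiv220412737, Assumption 1.1, Thm. 1.2 (Uniqueness and ergodicity) and the unnumbered remark p. 6 after Rem. 1.3 (Dobrushin route), Cor. 1.6 (Mass gap)] -/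
theorem strongCouplingFront_SU {N : ℕ} (hN : 2 ≤ N) {β₀ : ℝ} (hβ : β₀ < N / 48) :
    CrossoverLedger.StrongCouplingFront (fundamentalLatticeRep N) β₀ := by
  have hN0 : (0 : ℝ) < N := by exact_mod_cast (show 0 < N by omega)
  have hx : β₀ / N < 1 / 48 := by
    rw [div_lt_iff₀ hN0]
    linarith
  have hRlt : β₀ / N * 6 < 1 / 2 := by linarith
  have hpos : 0 < 1 / 2 - β₀ / N * 6 := by linarith
  refine strongCouplingFront_of_oneLinkKRModulus (by omega) (R := β₀ / N * 6) (K := 1 / (1 / 2 - β₀ / N * 6))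
    (one_div_pos.2 hpos).le le_rfl (oneLinkKRModulus_SU hN hRlt) ?_
  rw [← mul_div_assoc, mul_one, div_lt_one hpos]
  linarith

end Discharge

/-! ## Part B.1: the covariance form of the tilt-interpolation lemma (general measure theory) -/

section TiltCovariance

variable {S : Type*} [MeasurableSpace S]

/-- Variance is at most the second moment: `∫ (X − ∫X)² dμ ≤ ∫ X² dμ` on a probability space, for bounded
measurable `X`. [folklore] -/
theorem integral_sub_avg_sq_le {μ : Measure S} [IsProbabilityMeasure μ] {X : S → ℝ} (hXm : Measurable X)
    (hXb : ∃ C, ∀ s, |X s| ≤ C) :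
    ∫ s, (X s - ∫ s', X s' ∂μ) ^ 2 ∂μ ≤ ∫ s, X s ^ 2 ∂μ := by
  obtain ⟨C, hC⟩ := hXb
  set m : ℝ := ∫ s', X s' ∂μ with hm
  have hXi : Integrable X μ := integrable_of_measurable_of_abs_le hXm hC
  have hX2i : Integrable (fun s => X s ^ 2) μ :=
    integrable_of_measurable_of_abs_le (hXm.pow_const 2) (C := C ^ 2) fun s => by
      rw [abs_pow]; exact pow_le_pow_left₀ (abs_nonneg _) (hC s) 2
  have h : (fun s => (X s - m) ^ 2) = fun s => X s ^ 2 - 2 * m * X s + m ^ 2 := by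
    funext s; ring
  have hc : ∫ _ : S, m ^ 2 ∂μ = m ^ 2 := by simp
  have i1 : Integrable (fun s => X s ^ 2 - 2 * m * X s) μ := hX2i.sub (hXi.const_mul _)
  have i2 : Integrable (fun s => 2 * m * X s) μ := hXi.const_mul _
  rw [h, integral_add i1 (integrable_const _), integral_sub hX2i i2, integral_const_mul, hc, ← hm]
  nlinarith [sq_nonneg m]

/-- **The tilt-interpolation lemma, covariance form.**  Let `μ` be a probability measure, `f, w, φ` bounded
measurable and `ν_t = μ^{f + t w}` (`Measure.tilted`).  If `|Cov_{ν_t}(φ, w)| ≤ A` for all `t ∈ [0, 1]`, then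
`|∫ φ dν₁ − ∫ φ dν₀| ≤ A`.  (This is `|F(1) − F(0)| ≤ sup |F'|` for `F(t) = ∫ φ dν_t`, `F'(t) = Cov_{ν_t}(φ, w)`, proved
without differentiating under the integral: `ν_{t+h} = (ν_t)^{h w}` (`tilted_tilted`), one step is
`Cov_{ν_t}(φ, e^{hw}) / ν_t(e^{hw})` with `e^{hw} = 1 + h w + r`, `|r| ≤ (h‖w‖∞)²` (`Real.abs_exp_sub_one_sub_id_le`) and
`ν_t(e^{hw}) ≥ e^{−h‖w‖∞}`; `n` steps of size `1/n` cost `e^{‖w‖∞/n} (A + 2‖φ‖∞‖w‖∞²/n)`; let `n → ∞`.)  Compare the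
tree's `abs_integral_tilted_add_sub_le`, which is the special case where the covariance is bounded through two Poincaré
inequalities. [folklore] -/
theorem abs_integral_tilted_add_sub_le_of_cov {μ : Measure S} [IsProbabilityMeasure μ]
    {f w φ : S → ℝ} {A B : ℝ}
    (hf : Measurable f) (hfb : ∃ C, ∀ s, |f s| ≤ C) (hw : Measurable w) (hwB : ∀ s, |w s| ≤ B) (hφ : Measurable φ) (hφb : ∃ C, ∀ s, |φ s| ≤ C)
    (hC : ∀ t ∈ Set.Icc (0 : ℝ) 1,
      |∫ s, φ s * w s ∂μ.tilted (fun u => f u + t * w u) -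
          (∫ s, φ s ∂μ.tilted (fun u => f u + t * w u)) *
            ∫ s, w s ∂μ.tilted (fun u => f u + t * w u)| ≤ A) :
    |∫ s, φ s ∂μ.tilted (fun u => f u + w u) - ∫ s, φ s ∂μ.tilted f| ≤ A := by
  obtain ⟨Cf, hCf⟩ := hfb
  obtain ⟨Cφ, hCφ⟩ := hφb
  have hCφ0 : 0 ≤ Cφ := by
    rcases isEmpty_or_nonempty S with hS | ⟨⟨s⟩⟩
    · exact absurd (IsProbabilityMeasure.measure_univ (μ := μ)) (by simp [Set.univ_eq_empty_iff.2 hS])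
    · exact (abs_nonneg _).trans (hCφ s)
  have hA0 : 0 ≤ A := (abs_nonneg _).trans (hC 0 ⟨le_rfl, zero_le_one⟩)
  -- the tilt family
  set ν : ℝ → Measure S := fun t => μ.tilted (fun u => f u + t * w u) with hν
  have hmeas : ∀ t : ℝ, Measurable fun u => f u + t * w u := fun t => hf.add (hw.const_mul t)
  have hbdd : ∀ (t : ℝ) (u : S), |f u + t * w u| ≤ Cf + |t| * B := fun t u => by
    calc |f u + t * w u| ≤ |f u| + |t * w u| := abs_add_le _ _
      _ ≤ Cf + |t| * B := by
          rw [abs_mul]; exact add_le_add (hCf u) (mul_le_mul_of_nonneg_left (hwB u) (abs_nonneg t))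
  have hexpi : ∀ t : ℝ, Integrable (fun u => exp (f u + t * w u)) μ := fun t =>
    integrable_of_measurable_of_abs_le (hmeas t).exp (C := exp (Cf + |t| * B)) fun u => by
      rw [abs_of_nonneg (exp_pos _).le]
      exact exp_le_exp.2 ((le_abs_self _).trans (hbdd t u))
  haveI hprob : ∀ t, IsProbabilityMeasure (ν t) := fun t => isProbabilityMeasure_tilted (hexpi t)
  have hstep : ∀ t h : ℝ, ν (t + h) = (ν t).tilted (fun u => h * w u) := fun t h => by
    simp only [hν]
    rw [tilted_tilted (hexpi t)]
    congr 1
    funext u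
    simp only [Pi.add_apply]
    ring
  -- integrability facts
  have hφi : ∀ t, Integrable φ (ν t) := fun t => integrable_of_measurable_of_abs_le hφ hCφ
  have hwi : ∀ t, Integrable w (ν t) := fun t => integrable_of_measurable_of_abs_le hw hwB
  have hφwi : ∀ t, Integrable (fun s => φ s * w s) (ν t) := fun t =>
    integrable_of_measurable_of_abs_le (hφ.mul hw) (C := Cφ * B) fun s => by
      rw [abs_mul]; exact mul_le_mul (hCφ s) (hwB s) (abs_nonneg _) hCφ0
  -- one step of size `h`, `0 < h`, `h B ≤ 1`
  have hone : ∀ t ∈ Set.Icc (0 : ℝ) 1, ∀ h : ℝ, 0 < h → h * B ≤ 1 →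
      |∫ s, φ s ∂ν (t + h) - ∫ s, φ s ∂ν t| ≤ exp (h * B) * (h * A + 2 * Cφ * (h * B) ^ 2) := by
    intro t ht h hh hhB
    set ψ : S → ℝ := fun u => exp (h * w u) with hψ
    have hψm : Measurable ψ := (hw.const_mul h).exp
    have hhw : ∀ u, |h * w u| ≤ h * B := fun u => by
      rw [abs_mul, abs_of_pos hh]; exact mul_le_mul_of_nonneg_left (hwB u) hh.le
    have hψB : ∀ u, |ψ u| ≤ exp (h * B) := fun u => by
      rw [hψ, abs_of_nonneg (exp_pos _).le]
      exact exp_le_exp.2 ((le_abs_self _).trans (hhw u))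
    have hψpos : ∀ u, exp (-(h * B)) ≤ ψ u := fun u => exp_le_exp.2 (abs_le.1 (hhw u)).1
    have hψi : Integrable ψ (ν t) := integrable_of_measurable_of_abs_le hψm hψB
    -- the remainder `r = e^{hw} - 1 - h w`
    set r : S → ℝ := fun u => ψ u - 1 - h * w u with hrdef
    have hr : ∀ u, |r u| ≤ (h * B) ^ 2 := fun u => by
      have h1 : |h * w u| ≤ 1 := (hhw u).trans hhB
      calc |r u| = |exp (h * w u) - 1 - h * w u| := rfl
        _ ≤ (h * w u) ^ 2 := Real.abs_exp_sub_one_sub_id_le h1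
        _ ≤ (h * B) ^ 2 := by
            rw [← sq_abs]; exact pow_le_pow_left₀ (abs_nonneg _) (hhw u) 2
    have hrm : Measurable r := (hψm.sub measurable_const).sub (hw.const_mul h)
    have hri : Integrable r (ν t) := integrable_of_measurable_of_abs_le hrm hr
    have hrφi : Integrable (fun s => r s * φ s) (ν t) :=
      integrable_of_measurable_of_abs_le (hrm.mul hφ) (C := (h * B) ^ 2 * Cφ) fun s => by
        rw [abs_mul]; exact mul_le_mul (hr s) (hCφ s) (abs_nonneg _) (sq_nonneg _)
    -- the denominator
    have hZ : exp (-(h * B)) ≤ ∫ s, ψ s ∂ν t := by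
      calc exp (-(h * B)) = ∫ _s, exp (-(h * B)) ∂ν t := by simp
        _ ≤ ∫ s, ψ s ∂ν t := integral_mono (integrable_const _) hψi hψpos
    have hZpos : 0 < ∫ s, ψ s ∂ν t := (exp_pos _).trans_le hZ
    rw [hstep t h, integral_tilted_sub_integral_eq hψi, abs_div, abs_of_pos hZpos,
      div_le_iff₀ hZpos]
    -- decomposition of the numerator
    have hdecomp : ∫ s, exp (h * w s) * φ s ∂ν t - (∫ s, exp (h * w s) ∂ν t) * ∫ s, φ s ∂ν t =
        h * (∫ s, φ s * w s ∂ν t - (∫ s, φ s ∂ν t) * ∫ s, w s ∂ν t) +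
          (∫ s, r s * φ s ∂ν t - (∫ s, r s ∂ν t) * ∫ s, φ s ∂ν t) := by
      have e1 : (fun s => exp (h * w s) * φ s) = fun s => r s * φ s + φ s + h * (φ s * w s) := by
        funext s; simp only [hrdef, hψ]; ring
      have e2 : (fun s => exp (h * w s)) = fun s => r s + 1 + h * w s := by
        funext s; simp only [hrdef, hψ]; ring
      have j1 : Integrable (fun s => r s * φ s + φ s) (ν t) := hrφi.add (hφi t)
      have j2 : Integrable (fun s => h * (φ s * w s)) (ν t) := (hφwi t).const_mul h
      have j3 : Integrable (fun s => r s + 1) (ν t) := hri.add (integrable_const _)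
      have j4 : Integrable (fun s => h * w s) (ν t) := (hwi t).const_mul h
      have i1 : ∫ s, r s * φ s + φ s + h * (φ s * w s) ∂ν t =
          ∫ s, r s * φ s ∂ν t + ∫ s, φ s ∂ν t + h * ∫ s, φ s * w s ∂ν t := by
        rw [integral_add j1 j2, integral_add hrφi (hφi t), integral_const_mul]
      have i2 : ∫ s, r s + 1 + h * w s ∂ν t = ∫ s, r s ∂ν t + 1 + h * ∫ s, w s ∂ν t := by
        rw [integral_add j3 j4, integral_add hri (integrable_const _), integral_const_mul]
        simp
      rw [e1, e2, i1, i2]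
      ring
    rw [hdecomp]
    have i3 : |∫ s, φ s ∂ν t| ≤ Cφ := by
      refine abs_integral_le_integral_abs.trans ?_
      calc ∫ s, |φ s| ∂ν t ≤ ∫ _s, Cφ ∂ν t := integral_mono (hφi t).abs (integrable_const _) fun s => hCφ s
        _ = Cφ := by simp
    have i4 : |∫ s, r s * φ s ∂ν t| ≤ (h * B) ^ 2 * Cφ := by
      refine abs_integral_le_integral_abs.trans ?_
      calc ∫ s, |r s * φ s| ∂ν t ≤ ∫ _s, (h * B) ^ 2 * Cφ ∂ν t :=
            integral_mono hrφi.abs (integrable_const _) fun s => by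
              rw [abs_mul]; exact mul_le_mul (hr s) (hCφ s) (abs_nonneg _) (sq_nonneg _)
        _ = (h * B) ^ 2 * Cφ := by simp
    have i5 : |∫ s, r s ∂ν t| ≤ (h * B) ^ 2 := by
      refine abs_integral_le_integral_abs.trans ?_
      calc ∫ s, |r s| ∂ν t ≤ ∫ _s, (h * B) ^ 2 ∂ν t := integral_mono hri.abs (integrable_const _) hr
        _ = (h * B) ^ 2 := by simp
    have hcovr : |∫ s, r s * φ s ∂ν t - (∫ s, r s ∂ν t) * ∫ s, φ s ∂ν t| ≤ 2 * Cφ * (h * B) ^ 2 := by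
      calc |∫ s, r s * φ s ∂ν t - (∫ s, r s ∂ν t) * ∫ s, φ s ∂ν t|
          ≤ |∫ s, r s * φ s ∂ν t| + |(∫ s, r s ∂ν t) * ∫ s, φ s ∂ν t| := abs_sub _ _
        _ ≤ (h * B) ^ 2 * Cφ + (h * B) ^ 2 * Cφ := by
            rw [abs_mul]; exact add_le_add i4 (mul_le_mul i5 i3 (abs_nonneg _) (sq_nonneg _))
        _ = 2 * Cφ * (h * B) ^ 2 := by ring
    have hct := hC t ht
    calc |h * (∫ s, φ s * w s ∂ν t - (∫ s, φ s ∂ν t) * ∫ s, w s ∂ν t) +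
          (∫ s, r s * φ s ∂ν t - (∫ s, r s ∂ν t) * ∫ s, φ s ∂ν t)|
        ≤ |h * (∫ s, φ s * w s ∂ν t - (∫ s, φ s ∂ν t) * ∫ s, w s ∂ν t)| +
            |∫ s, r s * φ s ∂ν t - (∫ s, r s ∂ν t) * ∫ s, φ s ∂ν t| := abs_add_le _ _
      _ ≤ h * A + 2 * Cφ * (h * B) ^ 2 := by
          rw [abs_mul, abs_of_pos hh]
          exact add_le_add (mul_le_mul_of_nonneg_left hct hh.le) hcovr
      _ = exp (h * B) * (h * A + 2 * Cφ * (h * B) ^ 2) * exp (-(h * B)) := by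
          rw [exp_neg]; field_simp
      _ ≤ exp (h * B) * (h * A + 2 * Cφ * (h * B) ^ 2) * ∫ s, ψ s ∂ν t :=
          mul_le_mul_of_nonneg_left hZ (by positivity)
  -- telescoping over `n ≥ B` steps of size `1/n`
  have htel : ∀ n : ℕ, 0 < n → B ≤ n →
      |∫ s, φ s ∂ν 1 - ∫ s, φ s ∂ν 0| ≤ exp (B / n) * (A + 2 * Cφ * B ^ 2 / n) := by
    intro n hn hBn
    have hn' : (0 : ℝ) < n := by exact_mod_cast hn
    set a : ℕ → ℝ := fun k => ∫ s, φ s ∂ν (k / n) with ha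
    have h0 : a 0 = ∫ s, φ s ∂ν 0 := by simp [ha]
    have h1 : a n = ∫ s, φ s ∂ν 1 := by simp [ha, div_self hn'.ne']
    rw [← h1, ← h0, ← Finset.sum_range_sub a n]
    refine (Finset.abs_sum_le_sum_abs _ _).trans ?_
    have hhB : 1 / (n : ℝ) * B ≤ 1 := by
      rw [one_div_mul_eq_div]; exact (div_le_one hn').2 hBn
    have hk : ∀ k ∈ Finset.range n,
        |a (k + 1) - a k| ≤ exp (1 / n * B) * (1 / n * A + 2 * Cφ * (1 / n * B) ^ 2) := by
      intro k hk
      have hkn : (k : ℝ) / n ∈ Set.Icc (0 : ℝ) 1 :=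
        ⟨by positivity, (div_le_one hn').2 (by exact_mod_cast (Finset.mem_range.1 hk).le)⟩
      have hstep' := hone (k / n) hkn (1 / n) (by positivity) hhB
      have hidx : (k : ℝ) / n + 1 / n = ((k + 1 : ℕ) : ℝ) / n := by push_cast; ring
      rw [hidx] at hstep'
      exact hstep'
    calc ∑ k ∈ Finset.range n, |a (k + 1) - a k|
        ≤ ∑ _k ∈ Finset.range n, exp (1 / n * B) * (1 / n * A + 2 * Cφ * (1 / n * B) ^ 2) :=
          Finset.sum_le_sum hk
      _ = exp (B / n) * (A + 2 * Cφ * B ^ 2 / n) := by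
          rw [Finset.sum_const, Finset.card_range, nsmul_eq_mul]
          have e : (1 : ℝ) / n * B = B / n := by ring
          rw [e]
          field_simp
  -- let `n → ∞`
  have hlim : Tendsto (fun n : ℕ => exp (B / n) * (A + 2 * Cφ * B ^ 2 / n)) atTop (𝓝 A) := by
    have h1 : Tendsto (fun n : ℕ => B / (n : ℝ)) atTop (𝓝 0) := tendsto_const_div_atTop_nhds_zero_nat B
    have h2 : Tendsto (fun n : ℕ => exp (B / n)) atTop (𝓝 1) := by
      have := (continuous_exp.tendsto 0).comp h1
      rwa [exp_zero] at this
    have h3 : Tendsto (fun n : ℕ => 2 * Cφ * B ^ 2 / (n : ℝ)) atTop (𝓝 0) :=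
      tendsto_const_div_atTop_nhds_zero_nat _
    have h4 : Tendsto (fun n : ℕ => A + 2 * Cφ * B ^ 2 / (n : ℝ)) atTop (𝓝 A) := by
      simpa using h3.const_add A
    simpa using h2.mul h4
  have hmain : |∫ s, φ s ∂ν 1 - ∫ s, φ s ∂ν 0| ≤ A := by
    refine ge_of_tendsto hlim (Filter.eventually_atTop.2 ⟨Nat.ceil B + 1, fun n hn => htel n (by omega) ?_⟩)
    have : ((Nat.ceil B : ℕ) : ℝ) + 1 ≤ n := by exact_mod_cast hn
    linarith [Nat.le_ceil B]
  have hν1 : ν 1 = μ.tilted (fun u => f u + w u) := by simp [hν]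
  have hν0 : ν 0 = μ.tilted f := by simp [hν]
  rw [← hν1, ← hν0]
  exact hmain

/-- **Second moments under a small odd tilt.**  On a probability space let `|F| ≤ κ ≤ 1` and `G ≥ 0` be bounded
measurable with `∫ F = 0` and `∫ G F = 0`.  Then `∫ G dμ^{F} ≤ (1 + κ²/2 + 2κ³/9) ∫ G dμ`: the normalisation is
`∫ e^F ≥ ∫ (1 + F) = 1` and `e^F ≤ 1 + F + F²/2 + (2/9)|F|³` (Mathlib's `Real.exp_bound` with `n = 3`). [folklore] -/
theorem integral_tilted_le_of_odd {μ : Measure S} [IsProbabilityMeasure μ] {F G : S → ℝ} {κ : ℝ}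
    (hFm : Measurable F) (hFκ : ∀ s, |F s| ≤ κ) (hκ : κ ≤ 1) (hGm : Measurable G) (hG0 : ∀ s, 0 ≤ G s)
    (hGb : ∃ C, ∀ s, |G s| ≤ C) (hF0 : ∫ s, F s ∂μ = 0) (hGF : ∫ s, G s * F s ∂μ = 0) :
    ∫ s, G s ∂μ.tilted F ≤ (1 + κ ^ 2 / 2 + 2 * κ ^ 3 / 9) * ∫ s, G s ∂μ := by
  obtain ⟨C, hC⟩ := hGb
  have hC0 : ∀ s, G s ≤ C := fun s => (le_abs_self _).trans (hC s)
  have hFi : Integrable F μ := integrable_of_measurable_of_abs_le hFm hFκ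
  have hGi : Integrable G μ := integrable_of_measurable_of_abs_le hGm hC
  have hGFi : Integrable (fun s => G s * F s) μ :=
    integrable_of_measurable_of_abs_le (hGm.mul hFm) (C := C * κ) fun s => by
      rw [abs_mul]; exact mul_le_mul (hC s) (hFκ s) (abs_nonneg _) ((abs_nonneg _).trans (hC s))
  have hexpi : Integrable (fun s => exp (F s)) μ :=
    integrable_of_measurable_of_abs_le hFm.exp (C := exp κ) fun s => by
      rw [abs_of_nonneg (exp_pos _).le]; exact exp_le_exp.2 ((le_abs_self _).trans (hFκ s))
  have hexpGi : Integrable (fun s => exp (F s) * G s) μ :=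
    integrable_of_measurable_of_abs_le (hFm.exp.mul hGm) (C := exp κ * C) fun s => by
      rw [abs_mul, abs_of_nonneg (exp_pos _).le]
      exact mul_le_mul (exp_le_exp.2 ((le_abs_self _).trans (hFκ s))) (hC s) (abs_nonneg _) (exp_pos _).le
  -- the normalisation `Z ≥ 1`
  set Z : ℝ := ∫ s, exp (F s) ∂μ with hZ
  have hZ1 : 1 ≤ Z := by
    calc (1 : ℝ) = ∫ s, (F s + 1) ∂μ := by
          rw [integral_add hFi (integrable_const _), hF0]
          simp
      _ ≤ Z := integral_mono (hFi.add (integrable_const _)) hexpi fun s => add_one_le_exp (F s)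
  have hZpos : 0 < Z := one_pos.trans_le hZ1
  -- the pointwise Taylor bound
  have hpt : ∀ s, exp (F s) * G s ≤ (G s + G s * F s) + (κ ^ 2 / 2 + 2 * κ ^ 3 / 9) * G s := by
    intro s
    have h1 : |F s| ≤ 1 := (hFκ s).trans hκ
    have hb := Real.exp_bound h1 (n := 3) (by norm_num)
    have hs : ∑ m ∈ range 3, F s ^ m / (m.factorial : ℝ) = 1 + F s + F s ^ 2 / 2 := by
      simp [Finset.sum_range_succ, Nat.factorial]
    rw [hs] at hb
    have hb' : exp (F s) ≤ 1 + F s + F s ^ 2 / 2 + |F s| ^ 3 * (((3 : ℕ).succ : ℝ) / ((3 : ℕ).factorial * 3)) :=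
      by linarith [(abs_le.1 hb).2]
    have hnum : (((3 : ℕ).succ : ℝ) / ((3 : ℕ).factorial * 3)) = 2 / 9 := by norm_num [Nat.factorial]
    rw [hnum] at hb'
    have hκ0 : 0 ≤ κ := (abs_nonneg _).trans (hFκ s)
    have hF2 : F s ^ 2 ≤ κ ^ 2 := by
      rw [← sq_abs]; exact pow_le_pow_left₀ (abs_nonneg _) (hFκ s) 2
    have hF3 : |F s| ^ 3 ≤ κ ^ 3 := pow_le_pow_left₀ (abs_nonneg _) (hFκ s) 3
    have hexp : exp (F s) ≤ 1 + F s + (κ ^ 2 / 2 + 2 * κ ^ 3 / 9) := by nlinarith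
    have := mul_le_mul_of_nonneg_right hexp (hG0 s)
    nlinarith [hG0 s]
  -- integrate
  rw [integral_tilted]
  simp_rw [smul_eq_mul]
  have hrw : ∫ s, exp (F s) / (∫ x, exp (F x) ∂μ) * G s ∂μ = (∫ s, exp (F s) * G s ∂μ) / Z := by
    simp_rw [div_mul_eq_mul_div]
    exact integral_div _ _
  rw [hrw]
  have hnum : ∫ s, exp (F s) * G s ∂μ ≤ (1 + κ ^ 2 / 2 + 2 * κ ^ 3 / 9) * ∫ s, G s ∂μ := by
    calc ∫ s, exp (F s) * G s ∂μ
        ≤ ∫ s, (G s + G s * F s) + (κ ^ 2 / 2 + 2 * κ ^ 3 / 9) * G s ∂μ :=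
          integral_mono hexpGi ((hGi.add hGFi).add (hGi.const_mul _)) hpt
      _ = (∫ s, G s ∂μ) + 0 + (κ ^ 2 / 2 + 2 * κ ^ 3 / 9) * ∫ s, G s ∂μ := by
          have j1 : Integrable (fun s => G s + G s * F s) μ := hGi.add hGFi
          have j2 : Integrable (fun s => (κ ^ 2 / 2 + 2 * κ ^ 3 / 9) * G s) μ := hGi.const_mul _
          rw [integral_add j1 j2, integral_add hGi hGFi, integral_const_mul, hGF]
      _ = (1 + κ ^ 2 / 2 + 2 * κ ^ 3 / 9) * ∫ s, G s ∂μ := by ring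
  have hG : 0 ≤ ∫ s, G s ∂μ := integral_nonneg hG0
  have hnn : 0 ≤ ∫ s, exp (F s) * G s ∂μ := integral_nonneg fun s => mul_nonneg (exp_pos _).le (hG0 s)
  calc (∫ s, exp (F s) * G s ∂μ) / Z ≤ ∫ s, exp (F s) * G s ∂μ := div_le_self hnn hZ1
    _ ≤ (1 + κ ^ 2 / 2 + 2 * κ ^ 3 / 9) * ∫ s, G s ∂μ := hnum

end TiltCovariance

/-! ## Part B.2: `SU(2)` — quaternion units, Haar second moments of `Re tr(g Δ)` -/

section SUTwo

local notation "SU2" => Matrix.specialUnitaryGroup (Fin 2) ℂ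
local notation "M₂" => Matrix (Fin 2) (Fin 2) ℂ
local notation "σ₂" => haarProbability (Matrix.specialUnitaryGroup (Fin 2) ℂ)

/-- The Haar probability measure of `SU(2)` is left invariant (it is Mathlib's `haarMeasure ⊤`). [folklore] -/
theorem isMulLeftInvariant_haarProbability_su2 :
    (haarProbability (Matrix.specialUnitaryGroup (Fin 2) ℂ)).IsMulLeftInvariant := by
  unfold haarProbability; infer_instance

/-- A quaternion with `re² + imI² + imJ² + imK² = 1` has norm `1`. [folklore] -/
private theorem norm_quat_eq_one (q : ℍ) (h : q.re ^ 2 + q.imI ^ 2 + q.imJ ^ 2 + q.imK ^ 2 = 1) :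
    ‖q‖ = 1 := by
  have h1 : ‖q‖ * ‖q‖ = 1 := by
    rw [← Quaternion.normSq_eq_norm_mul_self, Quaternion.normSq_def']; exact h
  nlinarith [norm_nonneg q]

/-- The quaternion unit `i` as `diag(i, −i) ∈ SU(2)`. [folklore] -/
def elI : SU2 :=
  ⟨quatMatrix ⟨0, 1, 0, 0⟩,
    QuantumLattice.quatMatrix_mem_specialUnitaryGroup (norm_quat_eq_one ⟨0, 1, 0, 0⟩ (by norm_num))⟩

/-- The quaternion unit `j` as `[[0, 1], [−1, 0]] ∈ SU(2)`. [folklore] -/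
def elJ : SU2 :=
  ⟨quatMatrix ⟨0, 0, 1, 0⟩,
    QuantumLattice.quatMatrix_mem_specialUnitaryGroup (norm_quat_eq_one ⟨0, 0, 1, 0⟩ (by norm_num))⟩

/-- `−1 ∈ SU(2)`. [folklore] -/
def elN : SU2 :=
  ⟨quatMatrix ⟨-1, 0, 0, 0⟩,
    QuantumLattice.quatMatrix_mem_specialUnitaryGroup (norm_quat_eq_one ⟨-1, 0, 0, 0⟩ (by norm_num))⟩

/-- First row of `i · g`: multiplication of the first row of `g` by `i`. [folklore] -/
theorem elI_mul_coords (g : SU2) :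
    (((elI * g : SU2) : M₂) 0 0).re = -((g : M₂) 0 0).im ∧ (((elI * g : SU2) : M₂) 0 0).im = ((g : M₂) 0 0).re ∧
      (((elI * g : SU2) : M₂) 0 1).re = -((g : M₂) 0 1).im ∧ (((elI * g : SU2) : M₂) 0 1).im = ((g : M₂) 0 1).re := by
  have h : ∀ j, ((elI * g : SU2) : M₂) 0 j =
      quatMatrix ⟨0, 1, 0, 0⟩ 0 0 * (g : M₂) 0 j + quatMatrix ⟨0, 1, 0, 0⟩ 0 1 * (g : M₂) 1 j := fun j => by
    show (quatMatrix ⟨0, 1, 0, 0⟩ * (g : M₂)) 0 j = _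
    rw [Matrix.mul_apply, Fin.sum_univ_two]
  simp only [h, QuantumLattice.quatMatrix_apply_00, QuantumLattice.quatMatrix_apply_01, Complex.add_re,
    Complex.add_im, Complex.mul_re, Complex.mul_im]
  norm_num

/-- First row of `j · g`: `(−conj g₀₁, conj g₀₀)`. [folklore] -/
theorem elJ_mul_coords (g : SU2) :
    (((elJ * g : SU2) : M₂) 0 0).re = -((g : M₂) 0 1).re ∧ (((elJ * g : SU2) : M₂) 0 0).im = ((g : M₂) 0 1).im ∧
      (((elJ * g : SU2) : M₂) 0 1).re = ((g : M₂) 0 0).re ∧ (((elJ * g : SU2) : M₂) 0 1).im = -((g : M₂) 0 0).im := by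
  have h : ∀ j, ((elJ * g : SU2) : M₂) 0 j =
      quatMatrix ⟨0, 0, 1, 0⟩ 0 0 * (g : M₂) 0 j + quatMatrix ⟨0, 0, 1, 0⟩ 0 1 * (g : M₂) 1 j := fun j => by
    show (quatMatrix ⟨0, 0, 1, 0⟩ * (g : M₂)) 0 j = _
    rw [Matrix.mul_apply, Fin.sum_univ_two]
  have h10 := QuantumLattice.su2_apply_10 g
  have h11 := QuantumLattice.su2_apply_11 g
  simp only [h, h10, h11, QuantumLattice.quatMatrix_apply_00, QuantumLattice.quatMatrix_apply_01, Complex.add_re,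
    Complex.add_im, Complex.mul_re, Complex.mul_im, Complex.neg_re, Complex.neg_im, Complex.conj_re,
    Complex.conj_im]
  norm_num

/-- `(−1) · g = −g`. [folklore] -/
theorem coe_elN_mul (g : SU2) : ((elN * g : SU2) : M₂) = -(g : M₂) := by
  have h : (quatMatrix (⟨-1, 0, 0, 0⟩ : ℍ) : M₂) = -1 := by
    ext i j
    fin_cases i <;> fin_cases j <;>
      simp [QuantumLattice.quatMatrix_apply_00, QuantumLattice.quatMatrix_apply_01,
        QuantumLattice.quatMatrix_apply_10, QuantumLattice.quatMatrix_apply_11, Complex.ext_iff]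
  show quatMatrix ⟨-1, 0, 0, 0⟩ * (g : M₂) = _
  rw [h, Matrix.neg_mul, Matrix.one_mul]

/-- Integrals of functions odd under `g ↦ −g` vanish for the Haar measure of `SU(2)`. [folklore] -/
theorem integral_eq_zero_of_odd {H : SU2 → ℝ} (hH : ∀ g, H (elN * g) = -H g) : ∫ g, H g ∂σ₂ = 0 := by
  haveI := isMulLeftInvariant_haarProbability_su2
  have h1 : ∫ g, H (elN * g) ∂σ₂ = ∫ g, H g ∂σ₂ := integral_mul_left_eq_self H elN
  have h2 : ∫ g, H (elN * g) ∂σ₂ = -∫ g, H g ∂σ₂ := by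
    simp_rw [hH]; exact integral_neg H
  linarith

/-- `Re tr((−g) B) = −Re tr(g B)`: the one-link potential is odd. [folklore] -/
theorem re_trace_elN_mul (g : SU2) (B : M₂) :
    (((elN * g : SU2) : M₂) * B).trace.re = -(((g : M₂) * B).trace.re) := by
  rw [coe_elN_mul, Matrix.neg_mul, Matrix.trace_neg, Complex.neg_re]

/-- `∫ Re tr(g B) dHaar = 0` on `SU(2)`. [folklore] -/
theorem integral_re_trace_su2_mul (B : M₂) : ∫ g, ((g : M₂) * B).trace.re ∂σ₂ = 0 :=
  integral_eq_zero_of_odd fun g => re_trace_elN_mul g B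

/-- **`Re tr(g Δ)` is linear in the unit quaternion of `g`**: with `g = [[a, b], [−b̄, ā]]`,
`Re tr(g Δ) = Re a · (Re Δ₀₀ + Re Δ₁₁) + Im a · (Im Δ₁₁ − Im Δ₀₀) + Re b · (Re Δ₁₀ − Re Δ₀₁) − Im b · (Im Δ₁₀ + Im Δ₀₁)`.
[folklore] -/
theorem re_trace_su2_mul (g : SU2) (Δ : M₂) :
    ((g : M₂) * Δ).trace.re =
      ((g : M₂) 0 0).re * ((Δ 0 0).re + (Δ 1 1).re) + ((g : M₂) 0 0).im * ((Δ 1 1).im - (Δ 0 0).im) +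
        ((g : M₂) 0 1).re * ((Δ 1 0).re - (Δ 0 1).re) - ((g : M₂) 0 1).im * ((Δ 1 0).im + (Δ 0 1).im) := by
  rw [Matrix.trace_fin_two, Matrix.mul_apply, Matrix.mul_apply, Fin.sum_univ_two, Fin.sum_univ_two,
    QuantumLattice.su2_apply_10 g, QuantumLattice.su2_apply_11 g]
  simp only [Complex.add_re, Complex.mul_re, Complex.neg_re, Complex.neg_im, Complex.conj_re,
    Complex.conj_im]
  ring

/-- The coefficient vector has `|c(Δ)|² ≤ 2 ‖Δ‖_F²`. [folklore] -/
theorem coef_sq_le (Δ : M₂) :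
    ((Δ 0 0).re + (Δ 1 1).re) ^ 2 + ((Δ 1 1).im - (Δ 0 0).im) ^ 2 + ((Δ 1 0).re - (Δ 0 1).re) ^ 2 +
        ((Δ 1 0).im + (Δ 0 1).im) ^ 2 ≤ 2 * frobNorm Δ ^ 2 := by
  rw [frobNorm_sq, Fin.sum_univ_two, Fin.sum_univ_two, Fin.sum_univ_two, Complex.sq_norm, Complex.sq_norm,
    Complex.sq_norm, Complex.sq_norm, Complex.normSq_apply, Complex.normSq_apply, Complex.normSq_apply,
    Complex.normSq_apply]
  nlinarith [sq_nonneg ((Δ 0 0).re - (Δ 1 1).re), sq_nonneg ((Δ 1 1).im + (Δ 0 0).im),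
    sq_nonneg ((Δ 1 0).re + (Δ 0 1).re), sq_nonneg ((Δ 1 0).im - (Δ 0 1).im)]

/-- **Haar second moment of the one-link potential on `SU(2)`**:
`∫ (Re tr(g Δ))² dHaar = |c(Δ)|²/4` (left invariance under `i, j, k` and the Parseval identity
`∑_{u ∈ {1,i,j,k}} ⟨u q, c⟩² = |c|²` for unit `q`). [folklore] -/
theorem integral_sq_re_trace_su2_mul (Δ : M₂) :
    ∫ g, (((g : M₂) * Δ).trace.re) ^ 2 ∂σ₂ =
      (((Δ 0 0).re + (Δ 1 1).re) ^ 2 + ((Δ 1 1).im - (Δ 0 0).im) ^ 2 + ((Δ 1 0).re - (Δ 0 1).re) ^ 2 +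
        ((Δ 1 0).im + (Δ 0 1).im) ^ 2) / 4 := by
  set c₁ : ℝ := (Δ 0 0).re + (Δ 1 1).re with hc₁
  set c₂ : ℝ := (Δ 1 1).im - (Δ 0 0).im with hc₂
  set c₃ : ℝ := (Δ 1 0).re - (Δ 0 1).re with hc₃
  set c₄ : ℝ := (Δ 1 0).im + (Δ 0 1).im with hc₄
  haveI := isMulLeftInvariant_haarProbability_su2
  set F : SU2 → ℝ := fun g => (((g : M₂) * Δ).trace.re) ^ 2 with hF
  have hFc : Continuous F := (continuous_re_trace_su_mul Δ).pow 2
  have hml : ∀ h : SU2, Continuous fun g : SU2 => h * g := fun h => continuous_const.mul continuous_id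
  have hint : ∀ h : SU2, Integrable (fun g => F (h * g)) σ₂ := fun h =>
    (hFc.comp (hml h)).integrable_of_hasCompactSupport (HasCompactSupport.of_compactSpace _)
  have hFi : Integrable F σ₂ := hFc.integrable_of_hasCompactSupport (HasCompactSupport.of_compactSpace _)
  have hI : ∫ g, F (elI * g) ∂σ₂ = ∫ g, F g ∂σ₂ := integral_mul_left_eq_self F elI
  have hJ : ∫ g, F (elJ * g) ∂σ₂ = ∫ g, F g ∂σ₂ := integral_mul_left_eq_self F elJ
  have hK : ∫ g, F (elI * (elJ * g)) ∂σ₂ = ∫ g, F g ∂σ₂ := by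
    rw [integral_mul_left_eq_self (μ := σ₂) (fun g => F (elI * g)) elJ, hI]
  -- the pointwise Parseval identity
  have hpt : ∀ g : SU2, F g + F (elI * g) + F (elJ * g) + F (elI * (elJ * g)) =
      c₁ ^ 2 + c₂ ^ 2 + c₃ ^ 2 + c₄ ^ 2 := by
    intro g
    have hn := QuantumLattice.normSq_su2Quat g
    rw [Quaternion.normSq_def'] at hn
    simp only [QuantumLattice.su2Quat] at hn
    obtain ⟨i1, i2, i3, i4⟩ := elI_mul_coords g
    obtain ⟨j1, j2, j3, j4⟩ := elJ_mul_coords g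
    obtain ⟨k1, k2, k3, k4⟩ := elI_mul_coords (elJ * g)
    simp only [hF, re_trace_su2_mul, i1, i2, i3, i4, j1, j2, j3, j4, k1, k2, k3, k4]
    linear_combination (c₁ ^ 2 + c₂ ^ 2 + c₃ ^ 2 + c₄ ^ 2) * hn
  have hint2 : Integrable (fun g => F (elI * (elJ * g))) σ₂ :=
    (hFc.comp ((hml elI).comp (hml elJ))).integrable_of_hasCompactSupport (HasCompactSupport.of_compactSpace _)
  have j1 : Integrable (fun g => F g + F (elI * g)) σ₂ := hFi.add (hint elI)
  have j2 : Integrable (fun g => F g + F (elI * g) + F (elJ * g)) σ₂ := j1.add (hint elJ)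
  have hsum : ∫ g, (F g + F (elI * g) + F (elJ * g) + F (elI * (elJ * g))) ∂σ₂ = 4 * ∫ g, F g ∂σ₂ := by
    rw [integral_add j2 hint2, integral_add j1 (hint elJ), integral_add hFi (hint elI), hI, hJ, hK]
    ring
  have hconst : ∫ g, (F g + F (elI * g) + F (elJ * g) + F (elI * (elJ * g))) ∂σ₂ =
      c₁ ^ 2 + c₂ ^ 2 + c₃ ^ 2 + c₄ ^ 2 := by
    simp_rw [hpt]
    simp
  have h4 : 4 * ∫ g, F g ∂σ₂ = c₁ ^ 2 + c₂ ^ 2 + c₃ ^ 2 + c₄ ^ 2 := by rw [← hsum, hconst]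
  show ∫ g, F g ∂σ₂ = (c₁ ^ 2 + c₂ ^ 2 + c₃ ^ 2 + c₄ ^ 2) / 4
  linarith

/-! ## Part B.3: the sharpened one-link Kantorovich–Rubinstein modulus of `SU(2)` -/

/-- `|Re tr(g B)| ≤ √2 ‖B‖_F` on `SU(2)`. [folklore] -/
theorem abs_re_trace_su2_mul_le_frob (g : SU2) (B : M₂) :
    |((g : M₂) * B).trace.re| ≤ Real.sqrt 2 * frobNorm B := by
  have h := abs_re_trace_su_mul_le g B
  have hs : Real.sqrt ((2 : ℕ) : ℝ) = Real.sqrt 2 := by norm_num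
  rwa [hs] at h

/-- `|Re tr(g B)| ≤ 2 ‖B‖_op` on `SU(2)` (`‖B‖_F ≤ ‖B‖_op ‖1‖_F = √2 ‖B‖_op`). [folklore] -/
theorem abs_re_trace_su2_mul_le_opNorm (g : SU2) (B : M₂) :
    |((g : M₂) * B).trace.re| ≤ 2 * matrixOpNorm B := by
  have hone : frobNorm (1 : M₂) = Real.sqrt 2 := by
    have hsq : frobNorm (1 : M₂) ^ 2 = 2 := by
      rw [frobNorm_sq_of_mem_unitaryGroup (Submonoid.one_mem _)]; simp
    rw [← hsq, Real.sqrt_sq (frobNorm_nonneg _)]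
  have h2 : frobNorm B ≤ matrixOpNorm B * Real.sqrt 2 := by
    have := SUNBakryEmery.frobNorm_mul_le_matrixOpNorm_mul B (1 : M₂)
    rwa [Matrix.mul_one, hone] at this
  have hss : Real.sqrt 2 * Real.sqrt 2 = 2 := Real.mul_self_sqrt (by norm_num)
  calc |((g : M₂) * B).trace.re| ≤ Real.sqrt 2 * frobNorm B := abs_re_trace_su2_mul_le_frob g B
    _ ≤ Real.sqrt 2 * (matrixOpNorm B * Real.sqrt 2) := mul_le_mul_of_nonneg_left h2 (Real.sqrt_nonneg _)
    _ = 2 * matrixOpNorm B := by rw [mul_comm (matrixOpNorm B), ← mul_assoc, hss]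

/-- **The sharpened one-link KR modulus of `SU(2)`.**  For `0 ≤ R ≤ 1/4`:
`OneLinkKRModulus 2 R (√(2 (1 + 8R² + 128R³/9) / (1 − 2R)))`, i.e. for `‖B‖_op, ‖B'‖_op ≤ R` and `L`-Lipschitz `φ`
(Frobenius distance on `SU(2)`), `|ν_B(φ) − ν_{B'}(φ)| ≤ K(R) · L · ‖B − B'‖_F` with `K(R)² = 2 c(R)/(1 − 2R)`,
`c(R) = 1 + 8R² + 128R³/9`.  Ingredients: the covariance form of the tilt interpolation
(`abs_integral_tilted_add_sub_le_of_cov`) along `B_t = B + t(B' − B)` (`‖B_t‖_op ≤ R`); Cauchy–Schwarz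
(`abs_integral_mul_sub_le_of_variance_le`); `Var_{ν_{B_t}}(φ) ≤ L²/(2(1/2 − R))` from the TREE's Bakry–Émery theorem
`SUNBakryEmery.haarPoincare_SU`; and `Var_{ν_{B_t}}(w) ≤ E_{ν_{B_t}} w² ≤ c(R) E_Haar w² ≤ 2 c(R) ‖B' − B‖_F²` for
`w = 2 Re tr(g (B' − B))` (`integral_tilted_le_of_odd` with `|2 Re tr(g B_t)| ≤ 4R ≤ 1`, oddness under `g ↦ −g`, and the
exact Haar second moment `integral_sq_re_trace_su2_mul`).  At `R = 1/6` (Wilson `β_W = 1/9`): `K = 1.9658` against the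
Poincaré-only constant `1/(1/2 − R) = 3`. [folklore] -/
theorem oneLinkKRModulus_su2 {R : ℝ} (hR0 : 0 ≤ R) (hR : R ≤ 1 / 4) :
    OneLinkKRModulus 2 R (Real.sqrt (2 * (1 + 8 * R ^ 2 + 128 * R ^ 3 / 9) / (1 - 2 * R))) := by
  classical
  intro B B' hB hB' φ L hφm hφb hL hφL
  set c : ℝ := 1 + 8 * R ^ 2 + 128 * R ^ 3 / 9 with hc
  set Kc : ℝ := Real.sqrt (2 * c / (1 - 2 * R)) with hKc
  have h12 : 0 < 1 - 2 * R := by linarith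
  have h12' : (1 - 2 * R) ≠ 0 := h12.ne'
  have hc1 : 1 ≤ c := by
    have : 0 ≤ 8 * R ^ 2 + 128 * R ^ 3 / 9 := by positivity
    linarith
  have hKc0 : 0 ≤ Kc := Real.sqrt_nonneg _
  have hKc2 : Kc ^ 2 = 2 * c / (1 - 2 * R) := Real.sq_sqrt (by positivity)
  have h2 : ((2 : ℕ) : ℝ) = 2 := by norm_num
  rw [h2]
  -- the potentials, with the real numeral `2`
  set f : SU2 → ℝ := fun g => (2 : ℝ) * (((g : M₂) * B).trace.re) with hf
  set w : SU2 → ℝ := fun g => (2 : ℝ) * (((g : M₂) * (B' - B)).trace.re) with hw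
  have hfw : (fun g : SU2 => (2 : ℝ) * (((g : M₂) * B').trace.re)) = fun g => f g + w g := by
    funext g
    simp only [hf, hw, Matrix.mul_sub, Matrix.trace_sub, Complex.sub_re]
    ring
  rw [hfw, abs_sub_comm]
  have hfm : Measurable f := (continuous_const.mul (continuous_re_trace_su_mul B)).measurable
  have hwm : Measurable w := (continuous_const.mul (continuous_re_trace_su_mul (B' - B))).measurable
  have hfb : ∃ C, ∀ s, |f s| ≤ C := ⟨2 * (2 * matrixOpNorm B), fun s => by
    simp only [hf]
    rw [abs_mul, abs_two]
    exact mul_le_mul_of_nonneg_left (abs_re_trace_su2_mul_le_opNorm s B) zero_le_two⟩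
  set Bw : ℝ := 2 * (Real.sqrt 2 * frobNorm (B' - B)) with hBw
  have hwb : ∀ s, |w s| ≤ Bw := fun s => by
    simp only [hw, hBw]
    rw [abs_mul, abs_two]
    exact mul_le_mul_of_nonneg_left (abs_re_trace_su2_mul_le_frob s _) zero_le_two
  have key := abs_integral_tilted_add_sub_le_of_cov (μ := σ₂) (A := Kc * L * frobNorm (B' - B))
    hfm hfb hwm hwb hφm hφb ?_
  · rw [frobNorm_sub_comm]; exact key
  · intro t ht
    -- the interpolated tilt is the one-link law at `B_t`, `‖B_t‖_op ≤ R`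
    set Bt : M₂ := B + (t : ℂ) • (B' - B) with hBt
    have hft : (fun u : SU2 => f u + t * w u) = fun g : SU2 => (2 : ℝ) * (((g : M₂) * Bt).trace.re) := by
      funext g
      simp only [hf, hw, hBt, Matrix.mul_add, Matrix.mul_smul, Matrix.trace_add, Matrix.trace_smul,
        Complex.add_re, smul_eq_mul, Complex.re_ofReal_mul]
      ring
    have hBt_le : matrixOpNorm Bt ≤ R := by
      have h1 : Bt = ((1 - t : ℝ) : ℂ) • B + ((t : ℝ) : ℂ) • B' := by
        rw [hBt]
        push_cast
        simp only [smul_sub, sub_smul, one_smul]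
        abel
      rw [h1]
      calc matrixOpNorm (((1 - t : ℝ) : ℂ) • B + ((t : ℝ) : ℂ) • B')
          ≤ matrixOpNorm (((1 - t : ℝ) : ℂ) • B) + matrixOpNorm (((t : ℝ) : ℂ) • B') := matrixOpNorm_add_le _ _
        _ = (1 - t) * matrixOpNorm B + t * matrixOpNorm B' := by
            rw [matrixOpNorm_smul, matrixOpNorm_smul, Complex.norm_real, Complex.norm_real, Real.norm_eq_abs,
              Real.norm_eq_abs, abs_of_nonneg (by linarith [ht.2]), abs_of_nonneg ht.1]
        _ ≤ (1 - t) * R + t * R :=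
            add_le_add (mul_le_mul_of_nonneg_left hB (by linarith [ht.2])) (mul_le_mul_of_nonneg_left hB' ht.1)
        _ = R := by ring
    have hBt_lt : matrixOpNorm Bt < 1 / 2 := by linarith
    rw [hft]
    set F : SU2 → ℝ := fun g : SU2 => (2 : ℝ) * (((g : M₂) * Bt).trace.re) with hFdef
    set ν : Measure SU2 := Measure.tilted σ₂ F with hν
    have hFm : Measurable F := (continuous_const.mul (continuous_re_trace_su_mul Bt)).measurable
    have hFκ : ∀ s, |F s| ≤ 4 * R := fun s => by
      simp only [hFdef]
      rw [abs_mul, abs_two]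
      calc 2 * |((s : M₂) * Bt).trace.re| ≤ 2 * (2 * matrixOpNorm Bt) :=
            mul_le_mul_of_nonneg_left (abs_re_trace_su2_mul_le_opNorm s Bt) zero_le_two
        _ ≤ 4 * R := by linarith
    have hexpF : Integrable (fun s => exp (F s)) σ₂ :=
      integrable_of_measurable_of_abs_le hFm.exp (C := exp (4 * R)) fun s => by
        rw [abs_of_nonneg (exp_pos _).le]; exact exp_le_exp.2 ((le_abs_self _).trans (hFκ s))
    haveI : IsProbabilityMeasure ν := isProbabilityMeasure_tilted hexpF
    -- the variance of the observable: the tree's Bakry–Émery theorem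
    have hVφ : ∫ s, (φ s - ∫ s', φ s' ∂ν) ^ 2 ∂ν ≤ L ^ 2 / (1 - 2 * R) := by
      have hvar := SUNBakryEmery.haarPoincare_SU (N := 2) le_rfl Bt hBt_lt φ L hL hφL
      rw [h2, variance_eq_integral hφm.aemeasurable] at hvar
      refine hvar.trans ?_
      exact div_le_div_of_nonneg_left (sq_nonneg L) h12 (by linarith)
    -- the second moment of the perturbation: exact at `t`-independent Haar, transferred to the tilt
    have hw2 : ∀ s : SU2, w s ^ 2 = 4 * (((s : M₂) * (B' - B)).trace.re) ^ 2 := fun s => by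
      simp only [hw]; ring
    have hEσ : ∫ s, w s ^ 2 ∂σ₂ ≤ 2 * frobNorm (B' - B) ^ 2 := by
      simp_rw [hw2]
      rw [integral_const_mul, integral_sq_re_trace_su2_mul]
      linarith [coef_sq_le (B' - B)]
    have hF0 : ∫ s, F s ∂σ₂ = 0 := integral_eq_zero_of_odd fun g => by
      simp only [hFdef, re_trace_elN_mul]; ring
    have hGF : ∫ s, w s ^ 2 * F s ∂σ₂ = 0 := integral_eq_zero_of_odd fun g => by
      simp only [hw, hFdef, re_trace_elN_mul]; ring
    have h4R : 4 * R ≤ 1 := by linarith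
    have hw2m : Measurable fun s => w s ^ 2 := hwm.pow_const 2
    have hw2b : ∃ C, ∀ s, |w s ^ 2| ≤ C :=
      ⟨Bw ^ 2, fun s => by rw [abs_pow]; exact pow_le_pow_left₀ (abs_nonneg _) (hwb s) 2⟩
    have hEν : ∫ s, w s ^ 2 ∂ν ≤ c * (2 * frobNorm (B' - B) ^ 2) := by
      have ht := integral_tilted_le_of_odd (μ := σ₂) hFm hFκ h4R hw2m (fun s => sq_nonneg _) hw2b hF0 hGF
      have hcc : 1 + (4 * R) ^ 2 / 2 + 2 * (4 * R) ^ 3 / 9 = c := by simp only [hc]; ring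
      rw [hcc] at ht
      exact ht.trans (mul_le_mul_of_nonneg_left hEσ (by linarith))
    have hVw : ∫ s, (w s - ∫ s', w s' ∂ν) ^ 2 ∂ν ≤ (Kc * (1 - 2 * R) * frobNorm (B' - B)) ^ 2 / (1 - 2 * R) := by
      have hM : (Kc * (1 - 2 * R) * frobNorm (B' - B)) ^ 2 / (1 - 2 * R) = c * (2 * frobNorm (B' - B) ^ 2) := by
        rw [mul_pow, mul_pow, hKc2]
        field_simp
      rw [hM]
      exact (integral_sub_avg_sq_le hwm ⟨Bw, hwb⟩).trans hEν
    -- Cauchy–Schwarz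
    have hcov := abs_integral_mul_sub_le_of_variance_le (ν := ν) h12 hL
      (mul_nonneg (mul_nonneg hKc0 h12.le) (frobNorm_nonneg _)) hφm hφb hwm ⟨Bw, hwb⟩ hVφ hVw
    refine hcov.trans (le_of_eq ?_)
    field_simp

/-! ## Part C: the `SU(2)`, `d = 4` window `β_W ≤ 1/9`, hypothesis-free, in both currencies -/

/-- The sharpened modulus in Wilson units (`R = 3β_W/2`, `K = 4 K₂`): for `0 ≤ β_W ≤ 1/6`,
`OneLinkKRModulusSU2 β_W (√(2 (1 + 18 β_W² + 48 β_W³)/(1 − 3 β_W)) / 4)`. [folklore] -/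
theorem oneLinkKRModulusSU2_sharp {βW : ℝ} (h0 : 0 ≤ βW) (h6 : βW ≤ 1 / 6) :
    OneLinkKRModulusSU2 βW (Real.sqrt (2 * (1 + 18 * βW ^ 2 + 48 * βW ^ 3) / (1 - 3 * βW)) / 4) := by
  have h := oneLinkKRModulus_su2 (R := 3 * βW / 2) (by positivity) (by linarith)
  have e1 : (1 + 8 * (3 * βW / 2) ^ 2 + 128 * (3 * βW / 2) ^ 3 / 9) = 1 + 18 * βW ^ 2 + 48 * βW ^ 3 := by
    ring
  have e2 : (1 - 2 * (3 * βW / 2)) = 1 - 3 * βW := by ring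
  rw [e1, e2] at h
  unfold OneLinkKRModulusSU2
  convert h using 2
  ring

/-- **The window inequality.**  For `0 ≤ β_W ≤ 1/6` with `81 β_W² (1 + 18 β_W² + 48 β_W³) < 2 (1 − 3 β_W)` the
Dobrushin constant `18 β_W K₂` of the sharpened modulus is `< 1`. [folklore] -/
theorem su2_window_sharp {βW : ℝ} (h0 : 0 ≤ βW) (h6 : βW ≤ 1 / 6)
    (hwin : 81 * βW ^ 2 * (1 + 18 * βW ^ 2 + 48 * βW ^ 3) < 2 * (1 - 3 * βW)) :
    18 * βW * (Real.sqrt (2 * (1 + 18 * βW ^ 2 + 48 * βW ^ 3) / (1 - 3 * βW)) / 4) < 1 := by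
  have h13 : 0 < 1 - 3 * βW := by linarith
  rcases h0.eq_or_lt with h | hpos
  · rw [← h]; norm_num
  · have hX : 2 * (1 + 18 * βW ^ 2 + 48 * βW ^ 3) / (1 - 3 * βW) < (2 / (9 * βW)) ^ 2 := by
      rw [div_pow, div_lt_div_iff₀ h13 (by positivity)]
      nlinarith [hwin]
    have hs : Real.sqrt (2 * (1 + 18 * βW ^ 2 + 48 * βW ^ 3) / (1 - 3 * βW)) < 2 / (9 * βW) := by
      rw [Real.sqrt_lt' (by positivity)]; exact hX
    calc 18 * βW * (Real.sqrt (2 * (1 + 18 * βW ^ 2 + 48 * βW ^ 3) / (1 - 3 * βW)) / 4)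
        = (9 * βW / 2) * Real.sqrt (2 * (1 + 18 * βW ^ 2 + 48 * βW ^ 3) / (1 - 3 * βW)) := by ring
      _ < (9 * βW / 2) * (2 / (9 * βW)) := mul_lt_mul_of_pos_left hs (by positivity)
      _ = 1 := by field_simp

/-- The window inequality holds at `β_W = 1/9` (`313/243 < 4/3`). [folklore] -/
theorem su2_window_ninth :
    81 * (1 / 9 : ℝ) ^ 2 * (1 + 18 * (1 / 9 : ℝ) ^ 2 + 48 * (1 / 9 : ℝ) ^ 3) < 2 * (1 - 3 * (1 / 9 : ℝ)) := by
  norm_num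

/-- **SC-b, hypothesis-free, sharpened**: for `0 ≤ β₀W ≤ 1/6` in the window,
`StrongCouplingFront (fundamentalLatticeRep 2) (β₀W/2)` — volume-uniform exponential clustering of Wilson loops on every
torus `(ℤ/Lℤ)⁴`, at every Wilson coupling `≤ β₀W`. [folklore] -/
theorem su2_strongCouplingFront_sharp {β₀W : ℝ} (h0 : 0 ≤ β₀W) (h6 : β₀W ≤ 1 / 6)
    (hwin : 81 * β₀W ^ 2 * (1 + 18 * β₀W ^ 2 + 48 * β₀W ^ 3) < 2 * (1 - 3 * β₀W)) :
    CrossoverLedger.StrongCouplingFront (fundamentalLatticeRep 2) (β₀W / 2) :=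
  su2_strongCouplingFront_of_oneLinkKRModulus (by positivity) (oneLinkKRModulusSU2_sharp h0 h6)
    (su2_window_sharp h0 h6 hwin)

/-- **The `SU(2)`, `d = 4` strong-coupling front holds up to Wilson `β_W = 1/9`, hypothesis-free** (printed window:
`β_W < 1/12`).  Observatory of the non-perturbative crossover; no mass-gap claim. [folklore] -/
theorem su2_strongCouplingFront_ninth :
    CrossoverLedger.StrongCouplingFront (fundamentalLatticeRep 2) ((1 / 9 : ℝ) / 2) :=
  su2_strongCouplingFront_sharp (by norm_num) (by norm_num) su2_window_ninth

/-- **SC-a, hypothesis-free, sharpened**: for `0 ≤ β_W ≤ 1/6` in the window, the `SU(2)` Wilson DLR specification on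
`ℤ⁴` at `β_W` has a unique Gibbs measure and exponential clustering of Lipschitz cylinder covariances at rate
`−log max(18 β_W K₂(β_W), 1/2)`. [folklore] -/
theorem su2_dlrMassGap_sharp {βW : ℝ} (h0 : 0 ≤ βW) (h6 : βW ≤ 1 / 6)
    (hwin : 81 * βW ^ 2 * (1 + 18 * βW ^ 2 + 48 * βW ^ 3) < 2 * (1 - 3 * βW)) :
    HasUniqueGibbsMeasure (ymSpecification (d := 4) (fundamentalRep (Fin 2)) (2 * (βW / 4))) ∧
      DLRClusteringAt 4 2 (βW / 4)
        (-Real.log (max (18 * βW * (Real.sqrt (2 * (1 + 18 * βW ^ 2 + 48 * βW ^ 3) / (1 - 3 * βW)) / 4))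
          (1 / 2))) :=
  su2_dlrMassGap_of_oneLinkKRModulus h0 (by positivity) (oneLinkKRModulusSU2_sharp h0 h6)
    (su2_window_sharp h0 h6 hwin)

/-- SC-a below a window point: `0 ≤ β_W ≤ β₀W ≤ 1/6`, `β₀W` in the window ⇒ `DLRMassGapAt 4 2 (β_W/4)`. [folklore] -/
theorem su2_dlrMassGapAt_sharp {β₀W βW : ℝ} (h0 : 0 ≤ βW) (hle : βW ≤ β₀W) (h6 : β₀W ≤ 1 / 6)
    (hwin : 81 * β₀W ^ 2 * (1 + 18 * β₀W ^ 2 + 48 * β₀W ^ 3) < 2 * (1 - 3 * β₀W)) :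
    DLRMassGapAt 4 2 (βW / 4) :=
  su2_dlrMassGapAt_of_le h0 hle (by positivity) (oneLinkKRModulusSU2_sharp (h0.trans hle) h6)
    (su2_window_sharp (h0.trans hle) h6 hwin)

/-- **The `SU(2)`, `d = 4` DLR mass gap (unique Gibbs state, exponential clustering) holds for every Wilson
`0 ≤ β_W ≤ 1/9`, hypothesis-free** (printed window: `β_W < 1/12`).  Observatory of the non-perturbative crossover; no
mass-gap claim beyond the strong-coupling regime stated. [folklore] -/
theorem su2_dlrMassGapAt_ninth {βW : ℝ} (h0 : 0 ≤ βW) (h9 : βW ≤ 1 / 9) : DLRMassGapAt 4 2 (βW / 4) :=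
  su2_dlrMassGapAt_sharp h0 h9 (by norm_num) su2_window_ninth

end SUTwo

end Literature.MathematicalPhysics.QuantumFieldTheory.Balaban1983to89.StrongCouplingKernelWindow
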